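import Summits.BirchSwinnertonDyer.BirchSwinnertonDyer.Theorems.GoldfeldAllTwistsTwoConverseTwinHalfTraceSevenModEightAssembly
import Summits.BirchSwinnertonDyer.BirchSwinnertonDyer.Theorems.GoldfeldAllTwistsTwoConverseTwinGenusDescentSquares
import Literature.NumberTheory.EllipticCurves.HeegnerPointsShimuraReciprocity
import Literature.NumberTheory.QuadraticFields.AmbiguousClassesOrder
import HarnessLib

set_option linter.dupNamespace false -- namespace `…BirchSwinnertonDyer.BirchSwinnertonDyer…` is the cell's (D-0017 nested layout)
set_option autoImplicit false

/-!
# LINE C3⁺ (PHASE 2 of the mixed 2-rank-two family), file P2f: TORSION over the genus tower of `ℚ(√−2qp)` and the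
# CLASS-NUMBER inputs of the quarter-trace core (`4 ∣ h(−8qp)`; `2 ∥ [C : C²]` for `−qp`) — FACT-FREE

Cell `bsd-goldfeld`, seat `bsd-goldfeld-s1p-c3x` (gen 7); planner ORDER (ccxxix)/(ccxxxi) «LINE C3⁺, tranche 1», file P2f.
`--supports stmt-BirchSwinnertonDyer-20044` as a HELPER (rank axis). Theses-free; theorems only (no definition, no fact binder,
no `sorry`); FACT-FREE. Serves the hypotheses `h4 : ∀ x, 4•x = 0 → x ∈ {0, T}` and `κ = h/4 ∈ ℤ` of the quarter-trace core
`quarterTrace_parity` (file P2a `…TwinQuarterTraceCore`) in THEOREM A⁗ (memo `HOME/RK2-MIXED-FAMILY.md` §5′).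

CONTENT.
* §1 `cm7_mem_pair_of_four_zsmul_eq_zero`: over a field `F` of characteristic `0` with `−7, 7 ∉ F²`, every `u ∈ X₀(49)(F)` with
  `4u = O` lies in `{O, T}`, `T = (2, −1)` — from this seat's `cm7_exists_odd_nsmul_mem_pair` (A″ core: every torsion point has an
  ODD multiple in `{O, T}`), since an odd multiple of a point killed by `4` is `±` the point and `−T = T`.
* §2 `isSquare_rat_cases_of_quadratic_tower` + `not_isSquare_seven_genusTower_negEightTwoPrimes`: for `K` imaginary quadratic with
  `d_K = −8qp` (`q, p` primes `≠ 7`) and a tower `K ⊂ K₁ = K(θ₁) ⊂ J = K₁(θ₂)` of quadratic steps with `θ₁² = −q`, `θ₂² = p`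
  (the genus field `ℚ(√2, √−q, √p)` inside `K[1]`): **`−7, 7 ∉ J²`** — a rational square in `J` is, up to the factors
  `p, −q, −qp` and `d_K`, a rational square (c3's `isSquare_or_isSquare_mul_of_isSquare_algebraMap` twice and
  `isSquare_or_of_isSquare_algebraMap_rat`), and none of `±7·{1, p, −q, −qp}·{1, −8qp}` is (a `7` to the first power, or a sign).
  Also the tower's own non-membership inputs: `−q ∉ K²` (`not_isSquare_neg_q_of_discr`), `p ∉ K₁²` (`not_isSquare_p_quadraticStep`).
* §3 `index_range_sq_classGroup_QO_eq_four_negEightTwoPrimes` (`[C : C²] = 4` for the order of discriminant `−8qp`: Gauss, three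
  assigned characters, c3's `index_range_sq_classGroup_QO` + `assignedCharCount_neg_four_mul_of_mod_four_eq_two`), hence
  `four_dvd_natCard_classGroup_QO_negEightTwoPrimes` (`4 ∣ h(−8qp)`, so `κ = h/4` is an integer and `#Cl² = h/4`); and
  `index_range_sq_classGroup_QO_eq_two_negTwoPrimes` (`[C : C²] = 2` for `−qp`, odd discriminant with two prime factors) for the
  partner field `ℚ(√−qp)` of file P2e. The Rédei bits (`8 ∣ h(−8qp) ⟺ q ≡ 7 ∧ p ≡ 1 (mod 8)`; `h(−qp) ≡ 2 (4) ⟺ (p/q) = −1`) are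
  NOT proved here — THEOREM A⁗ carries `¬ 8 ∣ h` and `LiLiuTian2024.NoIdealClassOfOrderFour (−qp)` as hypotheses (ruling (ccxxxi)(3);
  numerically 594/594, kit j294319 §3(d)).

HONEST FRAMING: elementary field/torsion/genus-counting lemmas; no Heegner point, no `L`-value; no case of K12₂″ / twin″ is decided;
BSD is not proved by any of this.

References: Silverman–Tate, *Rational Points on Elliptic Curves* (2015) §3.5 [SilvermanTate2015]; D. Cox, *Primes of the form
x² + ny²* (2013) §3.A Prop. 3.11, §3.B Thm. 3.15 [Cox2013].
-/

noncomputable section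

open scoped Classical

open WeierstrassCurve Literature.NumberTheory.EllipticCurves Literature.Computability.Cryptography.Hallgren2005
open Literature.NumberTheory.QuadraticFields.Quadratic (index_range_sq_classGroup_QO)
open Literature.NumberTheory.QuadraticFields.BinaryQuadraticForm (assignedCharCount assignedCharCount_of_mod_four_eq_one
  assignedCharCount_neg_four_mul_of_mod_four_eq_two)

namespace Summit.BirchSwinnertonDyer.BirchSwinnertonDyer.Theorems.GoldfeldGoodTwists

/-! ## §1 `X₀(49)(F)[4] = {O, T}` when `−7, 7 ∉ F²` -/

section Torsion

variable {F : Type*} [Field F] [CharZero F]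

/-- **`X₀(49)(F)[4] ⊆ {O, T}`** for a field `F` of characteristic `0` with `−7, 7 ∉ F²`: if `4•u = O` then `u = O` or `u = T = (2,−1)`.
(An odd multiple of `u` lies in `{O, T}` by `cm7_exists_odd_nsmul_mem_pair`; for `4u = O` an odd multiple is `±u`; `−T = T`.)
[cite: SilvermanTate2015, §3.5] -/
theorem cm7_mem_pair_of_four_zsmul_eq_zero (h7 : ¬ IsSquare (-7 : F)) (h7' : ¬ IsSquare (7 : F))
    {u : (cm7.baseChange F).toAffine.Point} (hu : (4 : ℤ) • u = 0) :
    u = 0 ∨ u = Affine.Point.some 2 (-1) (nonsingular_cm7_baseChange_two_neg_one F) := by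
  have hfin : IsOfFinAddOrder u := isOfFinAddOrder_iff_zsmul_eq_zero.mpr ⟨4, by norm_num, hu⟩
  obtain ⟨n, hn, h⟩ := cm7_exists_odd_nsmul_mem_pair h7 h7' hfin
  have hTT := cm7_twoTorsion_add_self F
  -- `n • u = u` or `n • u = -u`
  have hcases : (n : ℤ) • u = u ∨ (n : ℤ) • u = -u := by
    obtain ⟨m, hm⟩ := hn
    have h4n : (∃ k : ℤ, (n : ℤ) = 4 * k + 1) ∨ (∃ k : ℤ, (n : ℤ) = 4 * k - 1) := by
      rcases Nat.even_or_odd m with ⟨j, hj⟩ | ⟨j, hj⟩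
      · left; exact ⟨j, by rw [hm, hj]; push_cast; ring⟩
      · right; exact ⟨j + 1, by rw [hm, hj]; push_cast; ring⟩
    rcases h4n with ⟨k, hk⟩ | ⟨k, hk⟩
    · left; rw [hk, add_zsmul, one_zsmul, mul_comm, mul_zsmul, hu, zsmul_zero, zero_add]
    · right; rw [hk, sub_zsmul, one_zsmul, mul_comm, mul_zsmul, hu, zsmul_zero]; simp
  have hnu : (n : ℤ) • u = n • u := natCast_zsmul u n
  rw [hnu] at hcases
  rcases hcases with h1 | h1 <;> rw [h1] at h
  · exact h
  · rcases h with h0 | h2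
    · left; exact neg_eq_zero.mp h0
    · right
      have hu' : u = -Affine.Point.some 2 (-1) (nonsingular_cm7_baseChange_two_neg_one F) := by rw [← h2, neg_neg]
      rw [hu', neg_eq_iff_add_eq_zero, hTT]

end Torsion

/-! ## §2 `−7, 7 ∉ J²` for the genus tower `K ⊂ K(√−q) ⊂ K(√−q, √p)`, `d_K = −8qp` -/

section Squares

/-- A natural number divisible by `7` exactly once (more generally: `7 ∣ n`, `49 ∤ n`) is not a square. [folklore] -/
theorem not_isSquare_nat_of_seven_dvd_not_sq_dvd {n : ℕ} (h7 : 7 ∣ n) (h49 : ¬ 49 ∣ n) : ¬ IsSquare n := by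
  rintro ⟨s, rfl⟩
  have h7s : 7 ∣ s := ((Nat.Prime.dvd_mul (by norm_num)).mp h7).elim id id
  obtain ⟨t, rfl⟩ := h7s
  exact h49 ⟨t * t, by ring⟩

/-- `7m` and `14m` are not squares for `m` coprime to `7` (`m = 1, q, p, qp` with primes `q, p ≠ 7`). [folklore] -/
theorem not_isSquare_seven_mul_of_not_dvd {m : ℕ} (hm : ¬ 7 ∣ m) : ¬ IsSquare (7 * m) ∧ ¬ IsSquare (14 * m) := by
  refine ⟨not_isSquare_nat_of_seven_dvd_not_sq_dvd ⟨m, rfl⟩ fun h => hm ?_,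
    not_isSquare_nat_of_seven_dvd_not_sq_dvd ⟨2 * m, by ring⟩ fun h => hm ?_⟩
  · obtain ⟨k, hk⟩ := h; omega
  · obtain ⟨k, hk⟩ := h; omega

variable {K : Type} {K₁ J : Type*} [Field K] [NumberField K] [Field K₁] [CharZero K₁] [Algebra K K₁] [Field J]
  [Algebra K₁ J]

/-- **Rational squares in a tower of two quadratic steps over an imaginary quadratic field.** `K` imaginary quadratic,
`K₁ = K(θ₁)` with `θ₁² = D₁ ∈ ℚ`, `θ₁ ∉ K`, `[K₁ : K] = 2`; `J = K₁(θ₂)` with `θ₂² = D₂ ∈ ℚ`, `θ₂ ∉ K₁`, `[J : K₁] = 2`. If a rational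
`c` is a square in `J` then one of `c·e·f` (`e ∈ {1, D₂, D₁, D₁D₂}`, `f ∈ {1, d_K}`) is a square in `ℚ`.
[cite: SilvermanTate2015, §3.5] -/
theorem isSquare_rat_cases_of_quadratic_tower (hK : IsImaginaryQuadratic K)
    (h₁ : Module.finrank K K₁ = 2) {θ₁ : K₁} {D₁ : ℚ} (hθ₁ : θ₁ ^ 2 = algebraMap K K₁ (algebraMap ℚ K D₁))
    (hθ₁K : ∀ a : K, algebraMap K K₁ a ≠ θ₁)
    (h₂ : Module.finrank K₁ J = 2) {θ₂ : J} {D₂ : ℚ} (hθ₂ : θ₂ ^ 2 = algebraMap K₁ J (algebraMap K K₁ (algebraMap ℚ K D₂)))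
    (hθ₂K : ∀ a : K₁, algebraMap K₁ J a ≠ θ₂)
    {c : ℚ} (hc : IsSquare (algebraMap K₁ J (algebraMap K K₁ (algebraMap ℚ K c)))) :
    ∃ e ∈ ({1, D₂, D₁, D₁ * D₂} : Finset ℚ), IsSquare (c * e) ∨ IsSquare (c * e * (NumberField.discr K : ℚ)) := by
  -- step `J / K₁`
  have step2 := isSquare_or_isSquare_mul_of_isSquare_algebraMap (two_ne_zero : (2 : K₁) ≠ 0) hθ₂ hθ₂K
    (exists_eq_add_mul_of_finrank_eq_two h₂ hθ₂K) hc
  -- step `K₁ / K`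
  have step1 : ∀ c' : ℚ, IsSquare (algebraMap K K₁ (algebraMap ℚ K c')) →
      IsSquare (algebraMap ℚ K c') ∨ IsSquare (algebraMap ℚ K (c' * D₁)) := fun c' hc' ↦ by
    rcases isSquare_or_isSquare_mul_of_isSquare_algebraMap (two_ne_zero : (2 : K) ≠ 0) hθ₁ hθ₁K
        (exists_eq_add_mul_of_finrank_eq_two h₁ hθ₁K) hc' with h | h
    · exact Or.inl h
    · right; rwa [← map_mul] at h
  -- step `K / ℚ`
  have step0 : ∀ c' : ℚ, IsSquare (algebraMap ℚ K c') → IsSquare c' ∨ IsSquare (c' * (NumberField.discr K : ℚ)) :=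
    fun c' hc' ↦ isSquare_or_of_isSquare_algebraMap_rat hK hc'
  have finish : ∀ c' : ℚ, IsSquare (algebraMap K K₁ (algebraMap ℚ K c')) →
      (IsSquare c' ∨ IsSquare (c' * (NumberField.discr K : ℚ))) ∨
        (IsSquare (c' * D₁) ∨ IsSquare (c' * D₁ * (NumberField.discr K : ℚ))) := fun c' hc' ↦ by
    rcases step1 c' hc' with h | h
    · exact Or.inl (step0 _ h)
    · exact Or.inr (step0 _ h)
  rcases step2 with h | h
  · rcases finish c h with h' | h'
    · exact ⟨1, by simp, by simpa using h'⟩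
    · exact ⟨D₁, by simp, h'⟩
  · rw [← map_mul, ← map_mul] at h
    rcases finish (c * D₂) h with h' | h'
    · exact ⟨D₂, by simp, h'⟩
    · refine ⟨D₁ * D₂, by simp, ?_⟩
      rcases h' with h'' | h''
      · left; convert h'' using 1; ring
      · right; convert h'' using 1; ring

/-- **`−7, 7 ∉ J²` for the genus tower of `d_K = −8qp`**: `K` imaginary quadratic with `d_K = −8qp`, `q, p` primes `≠ 7`,
`K₁ = K(θ₁)`, `θ₁² = −q`, `J = K₁(θ₂)`, `θ₂² = p` (quadratic steps, generators outside the base). None of the sixteen rationals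
`±7·{1, p, −q, −qp}·{1, −8qp}` is a square: the negative ones by sign, the positive ones carry `7` to the first power.
[cite: SilvermanTate2015, §3.5] -/
theorem not_isSquare_seven_genusTower_negEightTwoPrimes (hK : IsImaginaryQuadratic K) {q p : ℕ} (hq : q.Prime)
    (hp : p.Prime) (hq7 : q ≠ 7) (hp7 : p ≠ 7) (hdK : NumberField.discr K = -(8 * (q : ℤ) * p))
    (h₁ : Module.finrank K K₁ = 2) {θ₁ : K₁} (hθ₁ : θ₁ ^ 2 = algebraMap K K₁ (algebraMap ℚ K (-(q : ℚ))))
    (hθ₁K : ∀ a : K, algebraMap K K₁ a ≠ θ₁)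
    (h₂ : Module.finrank K₁ J = 2) {θ₂ : J} (hθ₂ : θ₂ ^ 2 = algebraMap K₁ J (algebraMap K K₁ (algebraMap ℚ K (p : ℚ))))
    (hθ₂K : ∀ a : K₁, algebraMap K₁ J a ≠ θ₂) :
    ¬ IsSquare (-7 : J) ∧ ¬ IsSquare (7 : J) := by
  have hdQ : ((NumberField.discr K : ℤ) : ℚ) = -(8 * (q : ℚ) * p) := by rw [hdK]; push_cast; ring
  have hq0 : (0 : ℚ) < q := by exact_mod_cast hq.pos
  have hp0 : (0 : ℚ) < p := by exact_mod_cast hp.pos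
  -- the positive candidates: `7`, `14qp`, `7p`, `14q`, `7q`, `14p`, `7qp`, `14`
  have hnd : ∀ m ∈ ({1, q, p, q * p} : Finset ℕ), ¬ 7 ∣ m := by
    intro m hm
    simp only [Finset.mem_insert, Finset.mem_singleton] at hm
    rcases hm with rfl | rfl | rfl | rfl
    · norm_num
    · exact fun h => hq7 ((Nat.prime_dvd_prime_iff_eq (by norm_num) hq).mp h).symm
    · exact fun h => hp7 ((Nat.prime_dvd_prime_iff_eq (by norm_num) hp).mp h).symm
    · intro h
      rcases (Nat.Prime.dvd_mul (by norm_num)).mp h with h' | h'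
      · exact hq7 ((Nat.prime_dvd_prime_iff_eq (by norm_num) hq).mp h').symm
      · exact hp7 ((Nat.prime_dvd_prime_iff_eq (by norm_num) hp).mp h').symm
  -- a rational that is `(positive non-square natural) × (rational square)` or negative is not a square
  have nsq : ∀ (n : ℕ), ¬ IsSquare n → ∀ (r : ℚ), r ≠ 0 → ∀ x : ℚ, x = n * r ^ 2 → ¬ IsSquare x := by
    rintro n hn r hr x rfl ⟨s, hs⟩
    apply hn
    have : IsSquare ((n : ℚ)) := ⟨s / r, by field_simp; linear_combination hs⟩
    exact Rat.isSquare_natCast_iff.mp this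
  have neg : ∀ x : ℚ, x < 0 → ¬ IsSquare x := fun x hx => not_isSquare_of_neg hx
  -- casting `(±7 : J)` as the image of `(±7 : ℚ)`
  have cast7 : ∀ c : ℚ, (c : J) = algebraMap K₁ J (algebraMap K K₁ (algebraMap ℚ K c)) := fun c ↦ by
    rw [eq_ratCast (algebraMap ℚ K) c, map_ratCast, map_ratCast]
  constructor
  · intro h
    rw [show (-7 : J) = ((-7 : ℚ) : J) by push_cast; ring, cast7] at h
    obtain ⟨e, he, hsq⟩ := isSquare_rat_cases_of_quadratic_tower hK h₁ hθ₁ hθ₁K h₂ hθ₂ hθ₂K h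
    simp only [Finset.mem_insert, Finset.mem_singleton] at he
    rcases he with rfl | rfl | rfl | rfl <;> rcases hsq with h' | h' <;> (try rw [hdQ] at h')
    · exact neg _ (by norm_num) h'
    · -- `-7 · (-8qp) = 14qp · 2²`
      exact nsq (14 * (q * p)) (not_isSquare_seven_mul_of_not_dvd (hnd _ (by simp))).2 2 two_ne_zero _
        (by push_cast; ring) h'
    · exact neg _ (by nlinarith) h'
    · -- `-7 p (-8qp) = 14q · (2p)²`
      exact nsq (14 * q) (not_isSquare_seven_mul_of_not_dvd (hnd q (by simp))).2 (2 * p) (by positivity) _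
        (by push_cast; ring) h'
    · -- `-7 · (-q) = 7q`
      exact nsq (7 * q) (not_isSquare_seven_mul_of_not_dvd (hnd q (by simp))).1 1 one_ne_zero _ (by push_cast; ring) h'
    · exact neg _ (by nlinarith [mul_pos hq0 hp0]) h'
    · -- `-7 · (-q p) = 7qp`
      exact nsq (7 * (q * p)) (not_isSquare_seven_mul_of_not_dvd (hnd _ (by simp))).1 1 one_ne_zero _
        (by push_cast; ring) h'
    · exact neg _ (by nlinarith [mul_pos hq0 hp0, mul_pos (mul_pos hq0 hp0) hq0]) h'
  · intro h
    rw [show (7 : J) = ((7 : ℚ) : J) by push_cast; ring, cast7] at h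
    obtain ⟨e, he, hsq⟩ := isSquare_rat_cases_of_quadratic_tower hK h₁ hθ₁ hθ₁K h₂ hθ₂ hθ₂K h
    simp only [Finset.mem_insert, Finset.mem_singleton] at he
    rcases he with rfl | rfl | rfl | rfl <;> rcases hsq with h' | h' <;> (try rw [hdQ] at h')
    · exact nsq 7 (not_isSquare_prime (by norm_num)) 1 one_ne_zero _ (by push_cast; ring) h'
    · exact neg _ (by nlinarith [mul_pos hq0 hp0]) h'
    · -- `7p`
      exact nsq (7 * p) (not_isSquare_seven_mul_of_not_dvd (hnd p (by simp))).1 1 one_ne_zero _ (by push_cast; ring) h'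
    · exact neg _ (by nlinarith [mul_pos hq0 hp0, mul_pos (mul_pos hq0 hp0) hp0]) h'
    · exact neg _ (by nlinarith) h'
    · -- `7 (-q)(-8qp) = 14p · (2q)²`
      exact nsq (14 * p) (not_isSquare_seven_mul_of_not_dvd (hnd p (by simp))).2 (2 * q) (by positivity) _
        (by push_cast; ring) h'
    · exact neg _ (by nlinarith [mul_pos hq0 hp0]) h'
    · -- `7 (-qp)(-8qp) = 14 · (2qp)²`
      exact nsq 14 (not_isSquare_seven_mul_of_not_dvd (m := 1) (by norm_num)).2 (2 * q * p) (by positivity) _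
        (by push_cast; ring) h'

/-- **`−q ∉ K²`** for `K` imaginary quadratic with `d_K = −8qp` (`q, p` primes, `p ≠ 2`): `−q < 0` and `−q·d_K = 2p·(2q)²` is
not a rational square. [folklore] -/
theorem not_isSquare_neg_q_of_discr_negEightTwoPrimes (hK : IsImaginaryQuadratic K) {q p : ℕ} (hq : q.Prime) (hp : p.Prime)
    (hp2 : p ≠ 2) (hdK : NumberField.discr K = -(8 * (q : ℤ) * p)) : ¬ IsSquare (algebraMap ℚ K (-(q : ℚ))) := by
  intro h
  have hdQ : ((NumberField.discr K : ℤ) : ℚ) = -(8 * (q : ℚ) * p) := by rw [hdK]; push_cast; ring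
  have hq0 : (0 : ℚ) < q := by exact_mod_cast hq.pos
  rcases isSquare_or_of_isSquare_algebraMap_rat hK h with h' | h'
  · exact not_isSquare_of_neg (by linarith) h'
  · rw [hdQ] at h'
    obtain ⟨s, hs⟩ := h'
    have h2p : IsSquare ((2 * p : ℕ) : ℚ) := ⟨s / (2 * q), by
      have : (q : ℚ) ≠ 0 := by exact_mod_cast hq.ne_zero
      field_simp; push_cast; linear_combination hs⟩
    have := Rat.isSquare_natCast_iff.mp h2p
    obtain ⟨t, ht⟩ := this
    have h2t : 2 ∣ t := ((Nat.Prime.dvd_mul Nat.prime_two).mp ⟨p, ht.symm⟩).elim id id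
    obtain ⟨u, rfl⟩ := h2t
    have : p = 2 * (u * u) := by linarith
    exact hp2 (hp.even_iff.mp ⟨u * u, by omega⟩)

omit [CharZero K₁] in
/-- **`p ∉ K(√−q)²`** (the second generator is outside the first step): if `p = a²` in `K₁ = K(θ₁)`, `θ₁² = −q`, then `p` or
`−pq` is a square in `K`, so one of `p, −8qp², −pq, 8q²p²` is a rational square — impossible. [folklore] -/
theorem not_isSquare_p_quadraticStep (hK : IsImaginaryQuadratic K) {q p : ℕ} (hq : q.Prime) (hp : p.Prime)
    (hdK : NumberField.discr K = -(8 * (q : ℤ) * p))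
    (h₁ : Module.finrank K K₁ = 2) {θ₁ : K₁} (hθ₁ : θ₁ ^ 2 = algebraMap K K₁ (algebraMap ℚ K (-(q : ℚ))))
    (hθ₁K : ∀ a : K, algebraMap K K₁ a ≠ θ₁) :
    ¬ IsSquare (algebraMap K K₁ (algebraMap ℚ K (p : ℚ))) := by
  intro h
  have hdQ : ((NumberField.discr K : ℤ) : ℚ) = -(8 * (q : ℚ) * p) := by rw [hdK]; push_cast; ring
  have hq0 : (0 : ℚ) < q := by exact_mod_cast hq.pos
  have hp0 : (0 : ℚ) < p := by exact_mod_cast hp.pos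
  rcases isSquare_or_isSquare_mul_of_isSquare_algebraMap two_ne_zero hθ₁ hθ₁K
      (exists_eq_add_mul_of_finrank_eq_two h₁ hθ₁K) h with h' | h'
  · rcases isSquare_or_of_isSquare_algebraMap_rat hK h' with h'' | h''
    · exact not_isSquare_prime hp (Rat.isSquare_natCast_iff.mp h'')
    · rw [hdQ] at h''; exact not_isSquare_of_neg (by nlinarith [mul_pos hq0 hp0]) h''
  · rw [← map_mul] at h'
    rcases isSquare_or_of_isSquare_algebraMap_rat hK h' with h'' | h''
    · exact not_isSquare_of_neg (by nlinarith [mul_pos hq0 hp0]) h''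
    · rw [hdQ] at h''
      obtain ⟨s, hs⟩ := h''
      have h2 : IsSquare ((2 : ℕ) : ℚ) := ⟨s / (2 * q * p), by
        have : (q : ℚ) ≠ 0 := by exact_mod_cast hq.ne_zero
        have : (p : ℚ) ≠ 0 := by exact_mod_cast hp.ne_zero
        field_simp; push_cast; linear_combination hs⟩
      exact not_isSquare_prime Nat.prime_two (Rat.isSquare_natCast_iff.mp h2)

end Squares

/-! ## §3 Genus counting: `[C : C²] = 4` for `−8qp`, `= 2` for `−qp` -/

section ClassNumber

/-- `primeFactors (2qp) = {2, q, p}` has three elements and `2qp ≡ 2 (mod 4)`, for odd primes `q ≠ p`. [folklore] -/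
theorem primeFactors_two_mul_two_primes {q p : ℕ} (hq : q.Prime) (hp : p.Prime) (hq2 : q ≠ 2) (hp2 : p ≠ 2) (hqp : q ≠ p) :
    (2 * q * p).primeFactors.card = 3 ∧ (2 * q * p) % 4 = 2 := by
  constructor
  · have h : (2 * q * p).primeFactors = {2, q, p} := by
      rw [Nat.primeFactors_mul (mul_ne_zero two_ne_zero hq.ne_zero) hp.ne_zero, Nat.primeFactors_mul two_ne_zero hq.ne_zero,
        Nat.prime_two.primeFactors, hq.primeFactors, hp.primeFactors]
      ext x; simp
    rw [h]
    exact Finset.card_eq_three.mpr ⟨2, q, p, hq2.symm, hp2.symm, hqp, rfl⟩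
  · obtain ⟨c, hc⟩ : Odd (q * p) := Nat.odd_mul.mpr ⟨hq.odd_of_ne_two hq2, hp.odd_of_ne_two hp2⟩
    rw [mul_assoc, hc]; omega

/-- **`[C(𝒪_{−8qp}) : C²] = 4`** (three assigned characters: `q`, `p` and one at `2`). [cite: Cox2013, §3.A Prop. 3.11 and §3.B Thm. 3.15] -/
theorem index_range_sq_classGroup_QO_eq_four_negEightTwoPrimes (Δ : OrderCl.NegDiscr) {q p : ℕ} (hq : q.Prime) (hp : p.Prime)
    (hq2 : q ≠ 2) (hp2 : p ≠ 2) (hqp : q ≠ p) (hΔ : Δ.D = -(8 * (q : ℤ) * p)) :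
    (powMonoidHom 2 : ClassGroup (OrderCl.QO Δ) →* ClassGroup (OrderCl.QO Δ)).range.index = 4 := by
  have hD4 : Δ.D % 4 = 0 ∨ Δ.D % 4 = 1 := Or.inl (by rw [hΔ]; exact Int.emod_eq_zero_of_dvd ⟨-(2 * q * p), by ring⟩)
  obtain ⟨hcard, hmod⟩ := primeFactors_two_mul_two_primes hq hp hq2 hp2 hqp
  rw [index_range_sq_classGroup_QO Δ hD4, hΔ, show (-(8 * (q : ℤ) * p)) = -4 * ((2 * q * p : ℕ) : ℤ) by push_cast; ring,
    assignedCharCount_neg_four_mul_of_mod_four_eq_two hmod, hcard]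
  norm_num

/-- **`4 ∣ h(−8qp)`.** [cite: Cox2013, §3.B Thm. 3.15] -/
theorem four_dvd_natCard_classGroup_QO_negEightTwoPrimes (Δ : OrderCl.NegDiscr) {q p : ℕ} (hq : q.Prime) (hp : p.Prime)
    (hq2 : q ≠ 2) (hp2 : p ≠ 2) (hqp : q ≠ p) (hΔ : Δ.D = -(8 * (q : ℤ) * p))
    [Finite (ClassGroup (OrderCl.QO Δ))] : 4 ∣ Nat.card (ClassGroup (OrderCl.QO Δ)) := by
  rw [← index_range_sq_classGroup_QO_eq_four_negEightTwoPrimes Δ hq hp hq2 hp2 hqp hΔ]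
  exact Subgroup.index_dvd_card _

/-- `#C = 4 · #C²` for `−8qp`: the quarter trace runs over `#C² = h/4` classes. [cite: Cox2013, §3.B Thm. 3.15] -/
theorem natCard_eq_four_mul_natCard_range_sq_negEightTwoPrimes (Δ : OrderCl.NegDiscr) {q p : ℕ} (hq : q.Prime) (hp : p.Prime)
    (hq2 : q ≠ 2) (hp2 : p ≠ 2) (hqp : q ≠ p) (hΔ : Δ.D = -(8 * (q : ℤ) * p)) [Finite (ClassGroup (OrderCl.QO Δ))] :
    Nat.card (ClassGroup (OrderCl.QO Δ)) =
      4 * Nat.card (powMonoidHom 2 : ClassGroup (OrderCl.QO Δ) →* ClassGroup (OrderCl.QO Δ)).range := by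
  rw [← index_range_sq_classGroup_QO_eq_four_negEightTwoPrimes Δ hq hp hq2 hp2 hqp hΔ, mul_comm,
    Subgroup.card_mul_index]

/-- **`[C(𝒪_{−qp}) : C²] = 2`** for the odd discriminant `−qp ≡ 1 (mod 4)` (two assigned characters) — the partner field `ℚ(√−qp)`
has `2`-rank one, so `LiLiuTian2024.NoIdealClassOfOrderFour (−qp)` says `#C² = h(−qp)/2` is odd.
[cite: Cox2013, §3.A Prop. 3.11 and §3.B Thm. 3.15] -/
theorem index_range_sq_classGroup_QO_eq_two_negTwoPrimes (Δ : OrderCl.NegDiscr) {q p : ℕ} (hq : q.Prime) (hp : p.Prime)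
    (hq2 : q ≠ 2) (hp2 : p ≠ 2) (hqp : q ≠ p) (hΔ : Δ.D = -((q : ℤ) * p)) (hΔ4 : Δ.D % 4 = 1) :
    (powMonoidHom 2 : ClassGroup (OrderCl.QO Δ) →* ClassGroup (OrderCl.QO Δ)).range.index = 2 := by
  have hfac : ((-((q : ℤ) * p)).natAbs.primeFactors.erase 2) = {q, p} := by
    rw [show (-((q : ℤ) * p)).natAbs = q * p by simp [Int.natAbs_mul], Nat.primeFactors_mul hq.ne_zero hp.ne_zero,
      hq.primeFactors, hp.primeFactors]
    ext x
    simp only [Finset.mem_erase, Finset.mem_union, Finset.mem_singleton, Finset.mem_insert]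
    constructor
    · rintro ⟨-, h⟩; exact h
    · rintro (rfl | rfl)
      · exact ⟨hq2, Or.inl rfl⟩
      · exact ⟨hp2, Or.inr rfl⟩
  rw [index_range_sq_classGroup_QO Δ (Or.inr hΔ4), assignedCharCount_of_mod_four_eq_one hΔ4, hΔ, hfac,
    Finset.card_pair hqp]
  norm_num

end ClassNumber

end Summit.BirchSwinnertonDyer.BirchSwinnertonDyer.Theorems.GoldfeldGoodTwists

end
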